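import Summits.AtomisticToContinuum.Crystallization.Theorems.FrustratedLawDichotomyCellTails
import Summits.AtomisticToContinuum.Crystallization.Theorems.FrustratedLawDichotomyCellEnclosures

/-!
# FrustratedLawDichotomy · crux `AperiodicFrustratedLawGap` (stmt-AtomisticToContinuum-27623) — CELL-SOUND IV: THE METRIC (GRAM) FRAME
(cell decomp-a2c, lens-5 g113; continues `…CellTails`; orientation-free cells)

Role.  `rootEnergy`, hard core, NASH and `coherentAt` are rotation-invariant, so a class-A row should be a box in the METRIC `G = FᵀF`
(6 parameters), not in `F` (9).  With affine placements `pos m = posL F (a m)` and multipliers `Y m = posL F (ω m)` (label vectors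
`a, ω : ι → Fin 3 → ℝ`), every atom of `…CellTailsRem.lb_le_certFloorL_trunc` is a function of `G` and label data:
1. `posL`, `gram`; linearity; ★ `inner_posL`, `norm_sq_posL`, `dist_posL` (inner products / squared norms = Gram values of `FᵀF`).
2. sqrt-free norm windows `norm_posL_le`, `le_norm_posL`; ★ `gram_mem_box` (metric box, known label data: two corners) and
   ★ `gram_le_of_boxes` (metric box × coordinate box: four corners then two, with (238) `mul_le_of_corners` / `corners_le_mul`).
3. ★ `ljBondForce_posL`, `ljBondForceLin_posL`, `inner_posL_ljBondForce`, `inner_posL_sum_ljBondForce` — forces and pairings in labels;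
   `posL_mirror` — the bond-reversal hypothesis of `…CellTails.sum_ljBondForce_eq_zero_of_mirror` is a label identity for affine hosts.
4. `linLab`, `nashVecLab`, ★ `nashVec_posL` — the near NASH residual `ψ(‖pos m‖²)pos m − certCoeffNearL … m` IS `posL F` of an explicit
   label vector, so `nn m` is certified by a coordinate box of `nashVecLab` (interval arithmetic in `ψ, ψ′` via (238) `psiT_mem`,
   `psiT1_mem`, and in `G`) followed by `gram_le_of_boxes` + `norm_posL_le`.

House conventions: SI units · italic scalars, bold vectors, sans-serif tensors (the metric *G* is a tensor) · numbered formulae only when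
referenced · en-dash for ranges · References = cited works, numbered, alphabetical · no footnotes; Remarks at section ends · British
spelling, -ise · Lennard-Jones hyphenated · "folklore" tags standard linear algebra; no new references are cited in this file.
-/

noncomputable section

namespace Summit.AtomisticToContinuum.Crystallization.Theorems.FrustratedLawDichotomyCellMetric

open RealInnerProductSpace
open scoped BigOperators
open Summit.AtomisticToContinuum.Crystallization.Theorems.ChargedEnergyGapNegative (E3)
open Summit.AtomisticToContinuum.Crystallization.Theorems.FrustratedLawDichotomyCoherentFloorAlgebra
open Summit.AtomisticToContinuum.Crystallization.Theorems.FrustratedLawDichotomyCellFrame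
open Summit.AtomisticToContinuum.Crystallization.Theorems.FrustratedLawDichotomyCellTails

variable {ι : Type*} [DecidableEq ι]

/-! ## §5. ★ The METRIC frame: affine placements `pos = posL F ∘ a`, the Gram form `gram (FᵀF)`, sqrt-free enclosures over a METRIC BOX
(orientation-free cells: a row is `{F : FᵀF ∈ Gbox}`; every atom of `lb_le_certFloorL_trunc` is a function of `G = FᵀF` and label data) -/

section MetricFrame

open Summit.AtomisticToContinuum.Crystallization.Theorems.FrustratedLawDichotomyCellEnclosures (mul_le_of_corners corners_le_mul)

/-- The affine placement of label coordinates `v : Fin 3 → ℝ` by the cell matrix `F` (columns = images of the label basis). -/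
def posL (F : Matrix (Fin 3) (Fin 3) ℝ) (v : Fin 3 → ℝ) : E3 := WithLp.toLp 2 (Matrix.mulVec F v)

/-- The Gram bilinear form of a `3×3` matrix `G` (used with the cell METRIC `G = FᵀF`). -/
def gram (G : Matrix (Fin 3) (Fin 3) ℝ) (v w : Fin 3 → ℝ) : ℝ := ∑ i, ∑ j, G i j * (v i * w j)

variable (F : Matrix (Fin 3) (Fin 3) ℝ)

omit [DecidableEq ι] in
/-- [folklore] -/
theorem posL_apply (v : Fin 3 → ℝ) (i : Fin 3) : posL F v i = ∑ j, F i j * v j := by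
  simp [posL, Matrix.mulVec, dotProduct]

omit [DecidableEq ι] in
/-- [folklore] -/
theorem posL_add (v w : Fin 3 → ℝ) : posL F (v + w) = posL F v + posL F w := by
  simp [posL, Matrix.mulVec_add]

omit [DecidableEq ι] in
/-- [folklore] -/
theorem posL_sub (v w : Fin 3 → ℝ) : posL F (v - w) = posL F v - posL F w := by
  simp [posL, Matrix.mulVec_sub]

omit [DecidableEq ι] in
/-- [folklore] -/
theorem posL_smul (c : ℝ) (v : Fin 3 → ℝ) : posL F (c • v) = c • posL F v := by
  simp [posL, Matrix.mulVec_smul]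

omit [DecidableEq ι] in
/-- [folklore] -/
theorem posL_zero : posL F 0 = 0 := by
  simp [posL]

omit [DecidableEq ι] in
/-- [folklore] -/
theorem posL_neg (v : Fin 3 → ℝ) : posL F (-v) = -posL F v := by
  simp [posL, Matrix.mulVec_neg]

omit [DecidableEq ι] in
/-- [folklore] -/
theorem posL_sum {α : Type*} (s : Finset α) (f : α → Fin 3 → ℝ) : posL F (∑ a ∈ s, f a) = ∑ a ∈ s, posL F (f a) := by
  classical
  induction s using Finset.induction_on with
  | empty => simp [posL_zero]
  | insert a s ha ih => rw [Finset.sum_insert ha, Finset.sum_insert ha, posL_add, ih]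

omit [DecidableEq ι] in
/-- ★ inner products of placed vectors are Gram-form values of the METRIC `FᵀF`. [folklore] -/
theorem inner_posL (v w : Fin 3 → ℝ) : ⟪posL F v, posL F w⟫ = gram (F.transpose * F) v w := by
  unfold gram
  simp only [PiLp.inner_apply, posL, Matrix.mulVec, dotProduct, Matrix.mul_apply, Matrix.transpose_apply,
    RCLike.inner_apply, conj_trivial]
  simp only [Finset.sum_mul, Finset.mul_sum]
  rw [Finset.sum_comm]
  refine Finset.sum_congr rfl fun i _ => ?_
  rw [Finset.sum_comm]
  refine Finset.sum_congr rfl fun j _ => Finset.sum_congr rfl fun k _ => ?_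
  ring

omit [DecidableEq ι] in
/-- [folklore] -/
theorem norm_sq_posL (v : Fin 3 → ℝ) : ‖posL F v‖ ^ 2 = gram (F.transpose * F) v v := by
  rw [← real_inner_self_eq_norm_sq, inner_posL]

omit [DecidableEq ι] in
/-- [folklore] -/
theorem dist_posL (v w : Fin 3 → ℝ) : dist (posL F v) (posL F w) = ‖posL F (v - w)‖ := by
  rw [dist_eq_norm, posL_sub]

omit [DecidableEq ι] in
/-- sqrt-free upper norm window: `gram v v ≤ b²`, `0 ≤ b` ⇒ `‖posL F v‖ ≤ b`. [folklore] -/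
theorem norm_posL_le {v : Fin 3 → ℝ} {b : ℝ} (hb : 0 ≤ b) (h : gram (F.transpose * F) v v ≤ b ^ 2) : ‖posL F v‖ ≤ b := by
  rw [← norm_sq_posL] at h
  exact (pow_le_pow_iff_left₀ (norm_nonneg _) hb two_ne_zero).mp h

omit [DecidableEq ι] in
/-- sqrt-free lower norm window: `b² ≤ gram v v`, `0 ≤ b` ⇒ `b ≤ ‖posL F v‖`. [folklore] -/
theorem le_norm_posL {v : Fin 3 → ℝ} {b : ℝ} (hb : 0 ≤ b) (h : b ^ 2 ≤ gram (F.transpose * F) v v) : b ≤ ‖posL F v‖ := by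
  rw [← norm_sq_posL] at h
  exact (pow_le_pow_iff_left₀ hb (norm_nonneg _) two_ne_zero).mp h

omit [DecidableEq ι] in
/-- one Gram term over an entry interval: `a ≤ g ≤ b` ⇒ `min (a c) (b c) ≤ g c ≤ max (a c) (b c)` (both signs of `c`). [folklore] -/
theorem mul_mem_corners₂ {a b g : ℝ} (c : ℝ) (h1 : a ≤ g) (h2 : g ≤ b) :
    min (a * c) (b * c) ≤ g * c ∧ g * c ≤ max (a * c) (b * c) := by
  rcases le_total 0 c with hc | hc
  · exact ⟨(min_le_left _ _).trans (mul_le_mul_of_nonneg_right h1 hc), (mul_le_mul_of_nonneg_right h2 hc).trans (le_max_right _ _)⟩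
  · exact ⟨(min_le_right _ _).trans (mul_le_mul_of_nonpos_right h2 hc), (mul_le_mul_of_nonpos_right h1 hc).trans (le_max_left _ _)⟩

omit [DecidableEq ι] in
/-- ★ METRIC-BOX ENCLOSURE of a Gram value at KNOWN (rational) label data: `Glo ≤ G ≤ Ghi` entrywise ⇒ the Gram value lies between the
two-corner sums — exactly what a K-file evaluates for host distances, debits, windows and mirror facts. [folklore] -/
theorem gram_mem_box {G Glo Ghi : Matrix (Fin 3) (Fin 3) ℝ} (hlo : ∀ i j, Glo i j ≤ G i j) (hhi : ∀ i j, G i j ≤ Ghi i j)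
    (v w : Fin 3 → ℝ) :
    ∑ i, ∑ j, min (Glo i j * (v i * w j)) (Ghi i j * (v i * w j)) ≤ gram G v w
      ∧ gram G v w ≤ ∑ i, ∑ j, max (Glo i j * (v i * w j)) (Ghi i j * (v i * w j)) := by
  unfold gram
  exact ⟨Finset.sum_le_sum fun i _ => Finset.sum_le_sum fun j _ => (mul_mem_corners₂ _ (hlo i j) (hhi i j)).1,
    Finset.sum_le_sum fun i _ => Finset.sum_le_sum fun j _ => (mul_mem_corners₂ _ (hlo i j) (hhi i j)).2⟩

omit [DecidableEq ι] in
/-- ★ METRIC-BOX × COORDINATE-BOX ENCLOSURE of `gram G W W` for a label vector `W` known only through coordinate intervals (the NASH residual,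
whose coefficients `ψ, ψ′` are themselves enclosed): four corners in `(W i, W j)`, then two-sided in `G i j`. [folklore] -/
theorem gram_le_of_boxes {G Glo Ghi : Matrix (Fin 3) (Fin 3) ℝ} (hlo : ∀ i j, Glo i j ≤ G i j) (hhi : ∀ i j, G i j ≤ Ghi i j)
    {W Wlo Whi : Fin 3 → ℝ} (h1 : ∀ i, Wlo i ≤ W i) (h2 : ∀ i, W i ≤ Whi i) :
    gram G W W ≤ ∑ i, ∑ j, max (max (Glo i j * min (min (Wlo i * Wlo j) (Wlo i * Whi j)) (min (Whi i * Wlo j) (Whi i * Whi j)))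
        (Glo i j * max (max (Wlo i * Wlo j) (Wlo i * Whi j)) (max (Whi i * Wlo j) (Whi i * Whi j))))
      (max (Ghi i j * min (min (Wlo i * Wlo j) (Wlo i * Whi j)) (min (Whi i * Wlo j) (Whi i * Whi j)))
        (Ghi i j * max (max (Wlo i * Wlo j) (Wlo i * Whi j)) (max (Whi i * Wlo j) (Whi i * Whi j)))) := by
  unfold gram
  refine Finset.sum_le_sum fun i _ => Finset.sum_le_sum fun j _ => ?_
  exact mul_le_of_corners (hlo i j) (hhi i j) (corners_le_mul (h1 i) (h2 i) (h1 j) (h2 j)) (mul_le_of_corners (h1 i) (h2 i) (h1 j) (h2 j))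

omit [DecidableEq ι] in
/-- ★ the smooth pair force of a placed bond, in label coordinates. [folklore] -/
theorem ljBondForce_posL (z : Fin 3 → ℝ) : ljBondForce (posL F z) = psiT (gram (F.transpose * F) z z) • posL F z := by
  unfold ljBondForce
  rw [norm_sq_posL]

omit [DecidableEq ι] in
/-- ★ the linearised pair force of a placed bond against a placed multiplier, in label coordinates:
`Dg(Fz)[Fy] = F (ψ(g_zz) y + (2 g_zy ψ′(g_zz)) z)`. [folklore] -/
theorem ljBondForceLin_posL (z y : Fin 3 → ℝ) :
    ljBondForceLin (posL F z) (posL F y)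
      = posL F (psiT (gram (F.transpose * F) z z) • y + (2 * gram (F.transpose * F) z y * psiT1 (gram (F.transpose * F) z z)) • z) := by
  unfold ljBondForceLin
  rw [norm_sq_posL, inner_posL, posL_add, posL_smul, posL_smul]

omit [DecidableEq ι] in
/-- ★ the host-force pairing of a placed multiplier with a placed bond force is a product of Gram data. [folklore] -/
theorem inner_posL_ljBondForce (y z : Fin 3 → ℝ) :
    ⟪posL F y, ljBondForce (posL F z)⟫ = psiT (gram (F.transpose * F) z z) * gram (F.transpose * F) y z := by
  rw [ljBondForce_posL, inner_smul_right, inner_posL]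

omit [DecidableEq ι] in
/-- ★ MIRROR FACT in labels: an affinely placed host is centrally symmetric about every site in LABEL space, so the bond-reversal hypothesis of
`sum_ljBondForce_eq_zero_of_mirror` is a label identity: `posL F a − posL F (2a − a') = −(posL F a − posL F a')`. [folklore] -/
theorem posL_mirror (a a' : Fin 3 → ℝ) : posL F a - posL F ((2 : ℝ) • a - a') = -(posL F a - posL F a') := by
  rw [posL_sub, posL_smul]
  abel_nf
  simp [two_smul]
  abel

omit [DecidableEq ι] in
/-- ★ a host-force pairing column entry in label coordinates: `⟪F y, Σ_near g(F z_a)⟫ = Σ_near ψ(g(z_a,z_a))·g(y,z_a)`. [folklore] -/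
theorem inner_posL_sum_ljBondForce {α : Type*} (y : Fin 3 → ℝ) (s : Finset α) (z : α → Fin 3 → ℝ) :
    ⟪posL F y, ∑ a ∈ s, ljBondForce (posL F (z a))⟫
      = ∑ a ∈ s, psiT (gram (F.transpose * F) (z a) (z a)) * gram (F.transpose * F) y (z a) := by
  rw [inner_sum]
  exact Finset.sum_congr rfl fun a _ => inner_posL_ljBondForce F y (z a)

/-- The linearised bond force in LABEL coordinates (`ljBondForceLin_posL`). -/
def linLab (G : Matrix (Fin 3) (Fin 3) ℝ) (z y : Fin 3 → ℝ) : Fin 3 → ℝ :=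
  psiT (gram G z z) • y + (2 * gram G z y * psiT1 (gram G z z)) • z

/-- The near NASH residual vector of site `m` in LABEL coordinates: `ψ(g(a_m,a_m)) a_m − c_y^{near}(m)` with label positions `a`, label
multipliers `ω` on `MI`, near-bond lists `nb` (`nashVec_posL`: its placement is the `E3` residual). -/
def nashVecLab (G : Matrix (Fin 3) (Fin 3) ℝ) (M MI : Finset ι) (a ω : ι → Fin 3 → ℝ) (nb : ι → Finset ι) (m : ι) :
    Fin 3 → ℝ :=
  psiT (gram G (a m) (a m)) • a m
    - ((if m ∈ MI then ∑ m' ∈ (M.erase m).filter (fun m' => m' ∈ nb m), linLab G (a m - a m') (ω m) else 0)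
      - ∑ x ∈ (MI.erase m).filter (fun x => x ∈ nb m), linLab G (a x - a m) (ω x))

/-- ★ THE NASH RESIDUAL IS A PLACED LABEL VECTOR: with `pos = posL F ∘ a`, `Y = posL F ∘ ω`,
`ψ(‖pos m‖²)·pos m − certCoeffNearL … m = posL F (nashVecLab (FᵀF) … m)` — so `nn m` is certified by `gram_le_of_boxes` + `norm_posL_le` from a
coordinate box of `nashVecLab` (interval arithmetic in `ψ, ψ′, G`). [folklore] -/
theorem nashVec_posL (M MI : Finset ι) (a ω : ι → Fin 3 → ℝ) (nb : ι → Finset ι) (m : ι) :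
    psiT (‖posL F (a m)‖ ^ 2) • posL F (a m) - certCoeffNearL M MI (fun m => posL F (a m)) (fun m => posL F (ω m)) nb m
      = posL F (nashVecLab (F.transpose * F) M MI a ω nb m) := by
  unfold certCoeffNearL nashVecLab
  rw [norm_sq_posL, posL_sub, posL_sub, posL_smul, posL_sum]
  congr 2
  · split_ifs
    · rw [posL_sum]
      refine Finset.sum_congr rfl fun m' _ => ?_
      rw [← posL_sub, ljBondForceLin_posL]; rfl
    · rw [posL_zero]
  · refine Finset.sum_congr rfl fun x _ => ?_
    rw [← posL_sub, ljBondForceLin_posL]; rfl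

end MetricFrame

end Summit.AtomisticToContinuum.Crystallization.Theorems.FrustratedLawDichotomyCellMetric
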